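import Literature.NumberTheory.EllipticCurves.CanonicalPAdicHeightKLocusProofs
import Literature.NumberTheory.Automorphic.IdeleIdealClass
import Mathlib.RingTheory.FractionalIdeal.Norm
import Mathlib.RingTheory.Norm.Transitivity
import Mathlib.FieldTheory.IsAlgClosed.AlgebraicClosure
import HarnessLib

/-!
# The canonical `p`-adic height over a number field `K`: the denominator ideal and Néron's law at
# the finite places, the global denominator identity, and the product formula at a split prime

Trunk T-NT-EC (Literature/NumberTheory/EllipticCurves); second proof file behind the named fact
`WeierstrassCurve.exists_isCanonicalK` (`CanonicalPAdicHeight.lean`), after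
`CanonicalPAdicHeightKLocusProofs.lean`. The sigma formula over `K` is
`ĥ_{p,K}(P) = log_p N𝔡(x(P)) - 2 Σ_ι log_p σ_p(z(ιP))` with `𝔡(x) = {r ∈ 𝓞_K | r x ∈ 𝓞_K}` the
denominator ideal (`WeierstrassCurve.denominatorIdeal`); this file PROVES the arithmetic of its
first term and the passage from the embeddings `K → ℚ_p` to the norm:

* `count_coe_denominatorIdeal` — **`val_𝔭(𝔡(x)) = max(0, -ord_𝔭 x)`** (`= max(0, log |x|_𝔭)` in
  Mathlib's `ℤᵐ⁰`-valued `HeightOneSpectrum.valuation`), i.e. `𝔡(x) = ∏ 𝔭^{max(0, -ord_𝔭 x)}`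
  (BCS 2015 §4.1: `x(P) = a_v/d_v²` locally), via Mathlib's `FractionalIdeal.count` and the
  tree's `FractionalIdeal.count_spanSingleton_eq_neg_log_valuation` (`IdeleIdealClass.lean`);
* `count_denominatorIdeal_parallelogram` — **Néron's quasi-parallelogram law at a finite place
  `v` of `K` in multiplicity form**, `val_v𝔡(x₃) + val_v𝔡(x₄) = 2val_v𝔡(x₁) + 2val_v𝔡(x₂) +
  2 ord_v(x₁ - x₂)` for a generic pair `P, Q ∈ E₀` at `v` with `P ± Q = (x₃, y₃), (x₄, y₄)`: the
  tree's generic law `max_v_addX_mul_max_v_addX_neg_mul_v_sub_sq` (`LocalDenominatorLaw.lean`,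
  Silverman ATAEC VI.4.1 + Ex. 6.3) for the integral model at `v`;
* `absNorm_denominatorIdeal_parallelogram` — the sum over the finite places:
  **`N𝔡(x₃)N𝔡(x₄) = N𝔡(x₁)²N𝔡(x₂)²N_{K/ℚ}(x₁ - x₂)²`** (the identity of fractional ideals
  `𝔡₃𝔡₄ = 𝔡₁²𝔡₂²(x₁ - x₂)²` and `FractionalIdeal.absNorm_span_singleton`), the `K`-version of
  `den_mul_den_eq`;
* `prod_embeddings_eq_norm` — **for `p` totally split (`#(K → ℚ_p) = [K:ℚ]`),
  `∏_ι ι(a) = N_{K/ℚ}(a)` in `ℚ_p`** (all embeddings into an algebraic closure of `ℚ_p` land in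
  `ℚ_p`; Mathlib `Algebra.norm_eq_prod_embeddings`) — MST 2006 §2.8: `ρ^K_cycl = ρ^ℚ_cycl ∘ N_{K/ℚ}`
  with `N_{K/ℚ} = ∏_{v∣p} N_{K_v/ℚ_p}` and `K_v = ℚ_p`;
* `padicLog_prod` — `log_p ∏ = Σ log_p` (from the tree's `padicLog_mul_holds`).

## Sources

* B. Mazur, W. Stein, J. Tate, Doc. Math. Extra Vol. Coates (2006), §2.4 (`σ̃_v`, `λ_v`, `d_w`),
  §2.6 (sum over all places), §2.8 (`h_p(P) = p⁻¹(Σ_{v∣p} log_p N_{K_v/ℚ_p} σ_v(P) -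
  Σ_{w∤p} ord_w(d_w(P)) log_p #k_w)`; read, PDF p. 10 of the held copy).
* J. H. Silverman, *ATAEC* (1994), Thm. VI.4.1, Ex. 6.3 (as cited by `LocalDenominatorLaw.lean`).
* J. Balakrishnan, M. Çiperiani, W. Stein, Math. Comp. 84 (2015), §4.1 eq. (4.1) (not held;
  statement as transcribed in `CanonicalPAdicHeight.lean`).

## Design notes

* Everything about `𝔡(x)` is proved for all `x` (for `x = 0`, `𝔡 = 𝓞_K` and both sides of the
  multiplicity formula are `0` by Mathlib's junk values `log 0 = 0`).
* The local law needs non-singular reduction of `P` and `Q` only (not of `P ± Q`), as in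
  `LocalDenominatorLaw.lean`.
-/

noncomputable section

open scoped Classical NNReal nonZeroDivisors
open IsDedekindDomain NumberField

namespace Literature.NumberTheory.EllipticCurves

/-! ### The denominator ideal: multiplicities, and Néron's law at the finite places of `K` -/

section DenominatorIdeal

open FractionalIdeal

variable (K : Type) [Field K] [NumberField K]

/-- A non-zero fractional ideal all of whose multiplicities are `≥ 0` is integral. [folklore] -/
theorem fractionalIdeal_le_one_of_count_nonneg {M : FractionalIdeal (𝓞 K)⁰ K} (hM : M ≠ 0)
    (h : ∀ w : HeightOneSpectrum (𝓞 K), 0 ≤ count K w M) : M ≤ 1 := by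
  rw [← finprod_heightOneSpectrum_factorization' K hM]
  refine finprod_induction (fun N : FractionalIdeal (𝓞 K)⁰ K => N ≤ 1) le_rfl
    (fun a b ha hb => mul_le_one' ha hb) (fun w => ?_)
  obtain ⟨n, hn⟩ := Int.eq_ofNat_of_zero_le (h w)
  rw [hn, zpow_natCast, ← coeIdeal_pow]
  exact coeIdeal_le_one

/-- Two non-zero fractional ideals with the same multiplicities are equal. [folklore] -/
theorem fractionalIdeal_eq_of_count_eq {I J : FractionalIdeal (𝓞 K)⁰ K} (hI : I ≠ 0) (hJ : J ≠ 0)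
    (h : ∀ w : HeightOneSpectrum (𝓞 K), count K w I = count K w J) : I = J := by
  rw [← finprod_heightOneSpectrum_factorization' K hI,
    ← finprod_heightOneSpectrum_factorization' K hJ]
  exact finprod_congr fun w => by rw [h w]

/-- The denominator ideal is non-zero (`x = s/d` with `d ≠ 0` integral). [folklore] -/
theorem denominatorIdeal_ne_bot (x : K) : WeierstrassCurve.denominatorIdeal K x ≠ ⊥ := by
  obtain ⟨d, s, hs⟩ := IsLocalization.exists_integer_multiple (𝓞 K)⁰ x
  intro h
  have hmem : ((d : (𝓞 K)⁰) : 𝓞 K) ∈ WeierstrassCurve.denominatorIdeal K x := by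
    refine ⟨s, ?_⟩
    rw [RingOfIntegers.coe_eq_algebraMap, RingOfIntegers.coe_eq_algebraMap, hs, Algebra.smul_def]
  rw [h, Ideal.mem_bot] at hmem
  exact nonZeroDivisors.coe_ne_zero d hmem

/-- **Multiplicities of the denominator ideal**: `val_v(𝔡(x)) = max(0, -ord_v(x))`
(`= max(0, log |x|_v)` with Mathlib's `|x|_v = exp(-ord_v x)`), i.e. `𝔡(x) = ∏ 𝔭^{max(0,-ord_𝔭 x)}`:
`𝔡(x)·(x) ⊆ 𝓞` gives `≥`, and the ideal `∏ 𝔭^{max(0,-ord_𝔭 x)}` lies in `𝔡(x)`, giving `≤`.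
[Balakrishnan–Çiperiani–Stein 2015, §4.1 (`d_v(P)`); folklore] [folklore] -/
theorem count_coe_denominatorIdeal (v : HeightOneSpectrum (𝓞 K)) (x : K) :
    count K v (WeierstrassCurve.denominatorIdeal K x : FractionalIdeal (𝓞 K)⁰ K) =
      max 0 (WithZero.log (v.valuation K x)) := by
  rcases eq_or_ne x 0 with rfl | hx
  · have htop : WeierstrassCurve.denominatorIdeal K (0 : K) = ⊤ :=
      (Ideal.eq_top_iff_one _).mpr ⟨0, by simp⟩
    rw [htop, coeIdeal_top, count_one, map_zero, WithZero.log_zero, max_self]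
  set J : FractionalIdeal (𝓞 K)⁰ K := ↑(WeierstrassCurve.denominatorIdeal K x) with hJ
  set I : FractionalIdeal (𝓞 K)⁰ K := spanSingleton (𝓞 K)⁰ x with hI
  have hI0 : I ≠ 0 := spanSingleton_ne_zero_iff.mpr hx
  have hJ0 : J ≠ 0 := coeIdeal_ne_zero.mpr (denominatorIdeal_ne_bot K x)
  have hcount : ∀ w : HeightOneSpectrum (𝓞 K), count K w I = -WithZero.log (w.valuation K x) :=
    fun w => Literature.NumberTheory.Automorphic.FractionalIdeal.count_spanSingleton_eq_neg_log_valuation w (Units.mk0 x hx)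
  -- `J * I ≤ 1`
  have hJI : J * I ≤ 1 := by
    rw [FractionalIdeal.mul_le]
    intro i hi j hj
    obtain ⟨r, hr, rfl⟩ := (mem_coeIdeal (S := (𝓞 K)⁰)).mp hi
    obtain ⟨z, rfl⟩ := (mem_spanSingleton (S := (𝓞 K)⁰)).mp hj
    obtain ⟨s, hs⟩ := hr
    refine (mem_one_iff (S := (𝓞 K)⁰)).mpr ⟨z * s, ?_⟩
    rw [map_mul, Algebra.smul_def, mul_left_comm, ← RingOfIntegers.coe_eq_algebraMap r, hs,
      RingOfIntegers.coe_eq_algebraMap]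
  -- lower bound
  have hge : max 0 (WithZero.log (v.valuation K x)) ≤ count K v J := by
    refine max_le (count_coe_nonneg K v _) ?_
    have := count_mono K v (mul_ne_zero hJ0 hI0) hJI
    rw [count_one, count_mul K v hJ0 hI0, hcount] at this
    linarith
  -- upper bound: the ideal `B = ∏ w^{max(0, log |x|_w)}` is contained in `J`
  have hfin : Set.Finite {w : HeightOneSpectrum (𝓞 K) |
      max 0 (WithZero.log (w.valuation K x)) ≠ 0} := by
    refine (finite_factors I).subset
      fun w (hw : max 0 (WithZero.log (w.valuation K x)) ≠ 0) => ?_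
    show ¬ (count K w I = 0)
    rw [hcount, neg_eq_zero]
    intro h0
    apply hw
    rw [h0, max_self]
  let e : HeightOneSpectrum (𝓞 K) →₀ ℤ := Finsupp.onFinset hfin.toFinset
    (fun w => max 0 (WithZero.log (w.valuation K x))) (fun w hw => hfin.mem_toFinset.mpr hw)
  have he : ∀ w, e w = max 0 (WithZero.log (w.valuation K x)) := fun w => Finsupp.onFinset_apply
  set B : FractionalIdeal (𝓞 K)⁰ K :=
    e.prod (fun w n => (w.asIdeal : FractionalIdeal (𝓞 K)⁰ K) ^ n) with hB
  have hB0 : B ≠ 0 :=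
    Finset.prod_ne_zero_iff.mpr fun w _ => zpow_ne_zero _ (coeIdeal_ne_zero.mpr w.ne_bot)
  have hcountB : ∀ w, count K w B = max 0 (WithZero.log (w.valuation K x)) := fun w => by
    rw [hB, count_finsuppProd, he]
  have hB1 : B ≤ 1 := fractionalIdeal_le_one_of_count_nonneg K hB0 fun w => by
    rw [hcountB]; exact le_max_left _ _
  have hBI : B * I ≤ 1 := fractionalIdeal_le_one_of_count_nonneg K (mul_ne_zero hB0 hI0) fun w => by
    rw [count_mul K w hB0 hI0, hcountB, hcount]
    have := le_max_right 0 (WithZero.log (w.valuation K x))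
    linarith
  have hBJ : B ≤ J := by
    intro b hb
    obtain ⟨r₀, hr₀⟩ := (mem_one_iff (S := (𝓞 K)⁰)).mp (hB1 hb)
    have hbx : b * x ∈ B * I := mul_mem_mul hb (mem_spanSingleton_self _ x)
    obtain ⟨s, hs⟩ := (mem_one_iff (S := (𝓞 K)⁰)).mp (hBI hbx)
    refine (mem_coeIdeal (S := (𝓞 K)⁰)).mpr ⟨r₀, ⟨s, ?_⟩, hr₀⟩
    rw [RingOfIntegers.coe_eq_algebraMap, RingOfIntegers.coe_eq_algebraMap, hr₀, hs]
  have hle : count K v J ≤ count K v B := count_mono K v hB0 hBJ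
  rw [hcountB] at hle
  exact le_antisymm hle hge

/-- `log(max(1, a)) = max(0, log a)` in `ℤᵐ⁰`. [folklore] -/
theorem withZero_log_max_one (a : WithZero (Multiplicative ℤ)) :
    WithZero.log (max 1 a) = max 0 (WithZero.log a) := by
  rcases eq_or_ne a 0 with rfl | ha
  · simp
  rcases le_total a 1 with h | h
  · rw [max_eq_left h, WithZero.log_one, max_eq_left]
    exact (WithZero.log_le_log ha one_ne_zero).mpr h
  · rw [max_eq_right h, max_eq_right]
    exact (WithZero.log_le_log one_ne_zero ha).mpr h

end DenominatorIdeal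

section LocalLaw

open FractionalIdeal

variable (W : WeierstrassCurve ℚ) [W.IsIntegral ℤ] (K : Type) [Field K] [NumberField K]

variable {W K} in
/-- **Néron's quasi-parallelogram law at a finite place of `K`, in multiplicity form.** For
`P = (x₁, y₁)`, `Q = (x₂, y₂) ∈ E(K)` with `x₁ ≠ x₂`, both with non-singular reduction at `v`, and
`P + Q = (x₃, y₃)`, `P - Q = (x₄, y₄)`:
`val_v 𝔡(x₃) + val_v 𝔡(x₄) = 2 val_v 𝔡(x₁) + 2 val_v 𝔡(x₂) + 2 val_v((x₁ - x₂))` — the generic law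
`max_v_addX_mul_max_v_addX_neg_mul_v_sub_sq` (`LocalDenominatorLaw.lean`, Silverman ATAEC VI.4.1 +
Ex. 6.3) for the integral model at `v`, read through `count_coe_denominatorIdeal`.
[Silverman ATAEC VI.4.1, Ex. 6.3; Mazur–Stein–Tate 2006, §2.4 (`σ̃_v`, `d_w(P)`)]
[cite: SilvermanATAEC1994, VI.4.1 and Ex. 6.3] -/
theorem count_denominatorIdeal_parallelogram (v : HeightOneSpectrum (𝓞 K)) {x₁ y₁ x₂ y₂ x₃ y₃ x₄ y₄ : K}
    (h₁ : (W.baseChange K).toAffine.Nonsingular x₁ y₁) (h₂ : (W.baseChange K).toAffine.Nonsingular x₂ y₂)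
    (h₃ : (W.baseChange K).toAffine.Nonsingular x₃ y₃) (h₄ : (W.baseChange K).toAffine.Nonsingular x₄ y₄)
    (hx : x₁ ≠ x₂)
    (hS : (.some x₁ y₁ h₁ : (W.baseChange K).toAffine.Point) + .some x₂ y₂ h₂ = .some x₃ y₃ h₃)
    (hD : (.some x₁ y₁ h₁ : (W.baseChange K).toAffine.Point) - .some x₂ y₂ h₂ = .some x₄ y₄ h₄)
    (hn₁ : W.HasNonsingularReductionAtK K v x₁ y₁) (hn₂ : W.HasNonsingularReductionAtK K v x₂ y₂) :
    count K v (WeierstrassCurve.denominatorIdeal K x₃ : FractionalIdeal (𝓞 K)⁰ K) +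
        count K v (WeierstrassCurve.denominatorIdeal K x₄ : FractionalIdeal (𝓞 K)⁰ K) =
      2 * count K v (WeierstrassCurve.denominatorIdeal K x₁ : FractionalIdeal (𝓞 K)⁰ K) +
        2 * count K v (WeierstrassCurve.denominatorIdeal K x₂ : FractionalIdeal (𝓞 K)⁰ K) +
        2 * count K v (spanSingleton (𝓞 K)⁰ (x₁ - x₂)) := by
  have hv := valuation_integers_valuationSubring (v.valuation K)
  have h₁' : ((placeIntModel W K v).baseChange K).toAffine.Nonsingular x₁ y₁ := h₁
  have h₂' : ((placeIntModel W K v).baseChange K).toAffine.Nonsingular x₂ y₂ := h₂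
  have hP : WeierstrassCurve.HasNonsingularReduction (K := K) (placeIntModel W K v) (.some x₁ y₁ h₁') :=
    (hasNonsingularReduction_placeIntModel_iff v h₁).mpr hn₁
  have hQ : WeierstrassCurve.HasNonsingularReduction (K := K) (placeIntModel W K v) (.some x₂ y₂ h₂') :=
    (hasNonsingularReduction_placeIntModel_iff v h₂).mpr hn₂
  have key := max_v_addX_mul_max_v_addX_neg_mul_v_sub_sq hv h₁' h₂' hx hP hQ
  rw [intModel_baseChange] at key
  -- the coordinates of `P ± Q`
  rw [WeierstrassCurve.Affine.Point.add_of_X_ne hx] at hS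
  rw [sub_eq_add_neg, WeierstrassCurve.Affine.Point.neg_some,
    WeierstrassCurve.Affine.Point.add_of_X_ne hx] at hD
  have hx₃ := (WeierstrassCurve.Affine.Point.some.injEq _ _ _ _ _ _).mp hS
  have hx₄ := (WeierstrassCurve.Affine.Point.some.injEq _ _ _ _ _ _).mp hD
  rw [hx₃.1, hx₄.1] at key
  -- logarithms
  have hδ : v.valuation K (x₁ - x₂) ≠ 0 := (Valuation.ne_zero_iff _).mpr (sub_ne_zero.mpr hx)
  have hm : ∀ a : WithZero (Multiplicative ℤ), max 1 a ≠ 0 := fun a =>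
    ne_of_gt (lt_of_lt_of_le zero_lt_one (le_max_left _ _))
  have klog := congrArg WithZero.log key
  rw [WithZero.log_mul (mul_ne_zero (hm _) (hm _)) (pow_ne_zero 2 hδ), WithZero.log_mul (hm _) (hm _),
    WithZero.log_mul (pow_ne_zero 2 (hm _)) (pow_ne_zero 2 (hm _)), WithZero.log_pow,
    WithZero.log_pow, WithZero.log_pow, withZero_log_max_one, withZero_log_max_one,
    withZero_log_max_one, withZero_log_max_one] at klog
  have hc : count K v (spanSingleton (𝓞 K)⁰ (x₁ - x₂)) = -WithZero.log (v.valuation K (x₁ - x₂)) :=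
    Literature.NumberTheory.Automorphic.FractionalIdeal.count_spanSingleton_eq_neg_log_valuation v
      (Units.mk0 (x₁ - x₂) (sub_ne_zero.mpr hx))
  rw [count_coe_denominatorIdeal, count_coe_denominatorIdeal, count_coe_denominatorIdeal,
    count_coe_denominatorIdeal, hc]
  simp only [nsmul_eq_mul, Nat.cast_ofNat] at klog
  linarith

end LocalLaw

/-! ### The global denominator identity over `K` -/

section GlobalLaw

open FractionalIdeal

variable (W : WeierstrassCurve ℚ) [W.IsIntegral ℤ] (K : Type) [Field K] [NumberField K]

variable {W K} in
/-- **`N𝔡(x(P+Q)) · N𝔡(x(P-Q)) = N𝔡(x(P))² · N𝔡(x(Q))² · N_{K/ℚ}(x(P) - x(Q))²`** for a generic pair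
of points of `E(K)` both reducing non-singularly at every finite place: the sum over the finite
places of `K` of Néron's local laws (`count_denominatorIdeal_parallelogram`) is the identity of
fractional ideals `𝔡(x₃)𝔡(x₄) = 𝔡(x₁)²𝔡(x₂)²(x₁ - x₂)²`, whose absolute norm is the claim
(`FractionalIdeal.absNorm_span_singleton`). The `K`-version of `den_mul_den_eq`.
[Silverman ATAEC VI.4.1, Ex. 6.3 (local law); Mazur–Stein–Tate 2006, §2.6, §2.8 (sum over the
places of `K`, `ord_w(d_w(P)) log_p #k_w`)] [folklore] -/
theorem absNorm_denominatorIdeal_parallelogram {x₁ y₁ x₂ y₂ x₃ y₃ x₄ y₄ : K}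
    (h₁ : (W.baseChange K).toAffine.Nonsingular x₁ y₁)
    (h₂ : (W.baseChange K).toAffine.Nonsingular x₂ y₂)
    (h₃ : (W.baseChange K).toAffine.Nonsingular x₃ y₃)
    (h₄ : (W.baseChange K).toAffine.Nonsingular x₄ y₄) (hx : x₁ ≠ x₂)
    (hS : (.some x₁ y₁ h₁ : (W.baseChange K).toAffine.Point) + .some x₂ y₂ h₂ = .some x₃ y₃ h₃)
    (hD : (.some x₁ y₁ h₁ : (W.baseChange K).toAffine.Point) - .some x₂ y₂ h₂ = .some x₄ y₄ h₄)
    (hns : ∀ v : HeightOneSpectrum (𝓞 K),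
      W.HasNonsingularReductionAtK K v x₁ y₁ ∧ W.HasNonsingularReductionAtK K v x₂ y₂) :
    (Ideal.absNorm (WeierstrassCurve.denominatorIdeal K x₃) : ℚ) *
        Ideal.absNorm (WeierstrassCurve.denominatorIdeal K x₄) =
      (Ideal.absNorm (WeierstrassCurve.denominatorIdeal K x₁) : ℚ) ^ 2 *
        (Ideal.absNorm (WeierstrassCurve.denominatorIdeal K x₂) : ℚ) ^ 2 *
        Algebra.norm ℚ (x₁ - x₂) ^ 2 := by
  set D : K → FractionalIdeal (𝓞 K)⁰ K := fun x => ↑(WeierstrassCurve.denominatorIdeal K x) with hDdef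
  have hD0 : ∀ x, D x ≠ 0 := fun x => coeIdeal_ne_zero.mpr (denominatorIdeal_ne_bot K x)
  set S : FractionalIdeal (𝓞 K)⁰ K := spanSingleton (𝓞 K)⁰ (x₁ - x₂) with hSdef
  have hS0 : S ≠ 0 := spanSingleton_ne_zero_iff.mpr (sub_ne_zero.mpr hx)
  have h12 : D x₁ ^ 2 * D x₂ ^ 2 ≠ 0 := mul_ne_zero (pow_ne_zero 2 (hD0 _)) (pow_ne_zero 2 (hD0 _))
  -- the identity of fractional ideals, prime by prime
  have hideal : D x₃ * D x₄ = D x₁ ^ 2 * D x₂ ^ 2 * S ^ 2 := by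
    refine fractionalIdeal_eq_of_count_eq K (mul_ne_zero (hD0 _) (hD0 _))
      (mul_ne_zero h12 (pow_ne_zero 2 hS0)) fun v => ?_
    rw [count_mul K v (hD0 _) (hD0 _), count_mul K v h12 (pow_ne_zero 2 hS0),
      count_mul K v (pow_ne_zero 2 (hD0 _)) (pow_ne_zero 2 (hD0 _)), count_pow, count_pow,
      count_pow]
    have := count_denominatorIdeal_parallelogram v h₁ h₂ h₃ h₄ hx hS hD (hns v).1 (hns v).2
    simp only [hDdef, hSdef] at this ⊢
    push_cast
    linarith
  -- absolute norms
  have hnorm := congrArg FractionalIdeal.absNorm hideal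
  rw [map_mul, map_mul, map_mul, map_pow, map_pow, map_pow] at hnorm
  simp only [hDdef, hSdef, coeIdeal_absNorm, absNorm_span_singleton (𝓞 K)] at hnorm
  rw [hnorm, sq_abs]

end GlobalLaw

/-! ### The places above a totally split `p`: `∏_ι ι(a) = N_{K/ℚ}(a)` -/

section Split

variable (K : Type) [Field K] [NumberField K] (p : ℕ) [Fact p.Prime]

variable {K p} in
/-- **For `p` totally split in `K` the embeddings `K → ℚ_p` compute the norm**: if there are
`[K : ℚ]` ring homomorphisms `K → ℚ_p`, then `∏_ι ι(a) = N_{K/ℚ}(a)` in `ℚ_p` for every `a ∈ K`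
(all `[K:ℚ]` embeddings of `K` into an algebraic closure of `ℚ_p` land in `ℚ_p`; Mathlib
`Algebra.norm_eq_prod_embeddings`). This is `N_{K/ℚ} = ∏_{v ∣ p} N_{K_v/ℚ_p}` with `K_v = ℚ_p`
(MST 2006, §2.8: `ρ^K_cycl = ρ^ℚ_cycl ∘ N_{K/ℚ}`). [Mazur–Stein–Tate 2006, §2.8] [folklore] -/
theorem prod_embeddings_eq_norm (hsplit : Fintype.card (K →+* ℚ_[p]) = Module.finrank ℚ K) (a : K) :
    ∏ ι : K →+* ℚ_[p], ι a = ((Algebra.norm ℚ a : ℚ) : ℚ_[p]) := by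
  let E := AlgebraicClosure ℚ_[p]
  let φ : (K →+* ℚ_[p]) → (K →ₐ[ℚ] E) := fun ι => ((algebraMap ℚ_[p] E).comp ι).toRatAlgHom
  have hφ : Function.Injective φ := fun ι₁ ι₂ h => by
    ext b
    apply (algebraMap ℚ_[p] E).injective
    have := AlgHom.congr_fun h b
    simpa [φ] using this
  have hbij : Function.Bijective φ :=
    (Fintype.bijective_iff_injective_and_card φ).mpr ⟨hφ, by rw [hsplit, AlgHom.card]⟩
  apply (algebraMap ℚ_[p] E).injective
  rw [map_prod, map_ratCast, ← eq_ratCast (algebraMap ℚ E), Algebra.norm_eq_prod_embeddings ℚ E,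
    ← (Equiv.ofBijective φ hbij).prod_comp]
  rfl

end Split

/-! ### `log_p` of a finite product -/

section Log

variable (p : ℕ) [Fact p.Prime]

/-- `log_p (∏ aᵢ) = Σ log_p aᵢ` for non-zero `aᵢ` (from `padicLog_mul_holds`). [Iwasawa 1972, §4.4]
[folklore] -/
theorem padicLog_prod {α : Type*} (s : Finset α) (f : α → ℚ_[p]) (hf : ∀ i ∈ s, f i ≠ 0) :
    padicLog p (∏ i ∈ s, f i) = ∑ i ∈ s, padicLog p (f i) := by
  induction s using Finset.induction_on with
  | empty => simp [padicLog_one]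
  | insert a s ha ih =>
    have hfs : ∀ i ∈ s, f i ≠ 0 := fun i hi => hf i (Finset.mem_insert_of_mem hi)
    rw [Finset.prod_insert ha, Finset.sum_insert ha,
      padicLog_mul_holds p (hf a (Finset.mem_insert_self a s)) (Finset.prod_ne_zero_iff.mpr hfs),
      ih hfs]

end Log


end Literature.NumberTheory.EllipticCurves
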